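import Mathlib
import Summits.Schanuel.Schanuel.Theorems.AclSubsetLogFreeCore.Negative.LogTwoHub
import Literature.ModelTheory.ExponentialFields.DefinabilityParams

/-!
# Crux `AclSubsetLogFreeCore` — the Kummer ladder: `2^{1/n} ∈ dcl(∅)` ⟺ the branch class `ln 2 + 2πi·nℤ` is `∅`-definable

Theorems for the crux (A) `RigidCore.AclSubsetLogFreeCore` (stmt-Schanuel-0968), cdisprove gen 5 (§15).

The definability half of every conceivable refutation of (A) passes through the hub
`ln 2 ∈ dcl^{ℂ_exp}(∅)` (`Negative/LogTwoHub`).  Between the hub and what IS provable there is a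
ladder indexed by `n ≥ 1`: rung `n` is the `∅`-definability of the class
`T₂(n) = {ln 2 + 2πink : k ∈ ℤ}` of branches of `log 2` with index divisible by `n`.
* `definable₁_branchClass_iff`: **rung `n` holds iff `2^{1/n} = e^{(ln 2)/n}` is pointwise `∅`-definable**
  (⟸: `T₂(n) = {x | e^x = 2 ∧ ∃ u (n u = x ∧ e^u = 2^{1/n})}`; ⟹: `{e^u | n u ∈ T₂(n)} = {2^{1/n}}`).
* rung `1` and rung `2` HOLD (`definable₁_branchClass_one`, `definable₁_branchClass_two`: `√2 ∈ dcl(∅)`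
  by the Kummer/cosine trick of `Negative/BranchParity`) — rung 2 is exactly the refuted branch
  indiscernibility;
* the top implies every rung (`definable₁_branchClass_of_log_two_mem_expDcl`);
* rung `3` (equivalently `2^{1/3} ∈ dcl^{ℂ_exp}(∅)`) is the OPEN question of Kirby–Macintyre–Onshuus
  (`Literature.ModelTheory.ExponentialFields.KMOTheoremTwoComplex` predicts it FAILS, as do all rungs
  `n ∤ 2`, since `2^{1/n} ∉ ℚ^{ab}` for `n ≥ 3`); under Zilber's conjecture all rungs `n ≥ 3` fail.
So a definability-side attack on (A) through the hub must in particular climb rung 3, i.e. settle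
KMO's question positively — against their conjecture.  Also recorded: the power map `(z, k) ↦ z^k` on
`ℂ* × ℤ` is `∅`-definable (`definable_zpowGraph`: `z^k = e^{kw}` for ANY logarithm `w` of `z`), whence
the roots of unity `μ_∞` form an `∅`-definable set (`definable₁_rootsOfUnity`, KMO §2).
-/

noncomputable section

set_option linter.dupNamespace false

open FirstOrder FirstOrder.Language Set
open Literature.ModelTheory.ExponentialFields

namespace Summit.Schanuel.Schanuel.Theorems.AclSubsetLogFreeCore.Negative

/-! ### The power map and the roots of unity -/

/-- **The power map is `∅`-definable on `ℂ* × ℤ`**: the graph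
`{(z, k, y) | z ≠ 0, k ∈ ℤ, y = z^k}` is `{(z, k, y) | z ≠ 0 ∧ k ∈ ℤ ∧ ∃ w (e^w = z ∧ y = e^{kw})}`
(for integral `k`, `e^{kw} = (e^w)^k` does not depend on the branch `w`). [cite: KirbyMacintyreOnshuus2012, §2] -/
theorem definable_zpowGraph :
    (∅ : Set ℂ).Definable Language.expRing
      {v : Fin 3 → ℂ | v 0 ≠ 0 ∧ ∃ k : ℤ, v 1 = k ∧ v 2 = v 0 ^ k} := by
  have hdef : (∅ : Set ℂ).Definable Language.expRing
      {v : Fin 3 → ℂ | ¬ v 0 = 0 ∧ (v 1 ∈ intSet ∧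
        ∃ w, Complex.exp w = v 0 ∧ v 2 = Complex.exp (v 1 * w))} := by
    refine definable_setOf_and_params (definable_setOf_not_params
      (definable_setOf_eq_params (definableFun_proj_params _) definableFun_zero'))
      (definable_setOf_and_params (definable_mem_intSet (definableFun_proj_params _)) ?_)
    refine definable_setOf_exists_params (definable_setOf_and_params ?_ ?_)
    · exact definable_setOf_eq_params (definableFun_cexp (definableFun_proj_params _))
        (definableFun_proj_params _)
    · exact definable_setOf_eq_params (definableFun_proj_params _)
        (definableFun_cexp (definableFun_mul' (definableFun_proj_params _)
          (definableFun_proj_params _)))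
  have heq : {v : Fin 3 → ℂ | v 0 ≠ 0 ∧ ∃ k : ℤ, v 1 = k ∧ v 2 = v 0 ^ k} =
      {v : Fin 3 → ℂ | ¬ v 0 = 0 ∧ (v 1 ∈ intSet ∧
        ∃ w, Complex.exp w = v 0 ∧ v 2 = Complex.exp (v 1 * w))} := by
    ext v
    simp only [Set.mem_setOf_eq, mem_intSet_iff]
    constructor
    · rintro ⟨h0, k, hk, h2⟩
      refine ⟨h0, ⟨k, hk⟩, Complex.log (v 0), Complex.exp_log h0, ?_⟩
      rw [h2, hk, Complex.exp_int_mul, Complex.exp_log h0]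
    · rintro ⟨h0, ⟨k, hk⟩, w, hw, h2⟩
      refine ⟨h0, k, hk, ?_⟩
      rw [h2, hk, Complex.exp_int_mul, hw]
  rw [heq]
  exact hdef

/-- **The roots of unity form an `∅`-definable set** `{z | ∃ n ≥ 1, z^n = 1}`
(`= {z | ∃ k ∈ ℤ ∖ {0} ∃ w (e^w = z ∧ e^{kw} = 1)}`). [cite: KirbyMacintyreOnshuus2012, §2.1] -/
theorem definable₁_rootsOfUnity :
    Set.Definable₁ (∅ : Set ℂ) Language.expRing {z : ℂ | ∃ n : ℕ, 0 < n ∧ z ^ n = 1} := by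
  have hdef : Set.Definable₁ (∅ : Set ℂ) Language.expRing
      {z : ℂ | ∃ k : ℂ, (k ∈ intSet ∧ ¬ k = 0) ∧
        ∃ w, Complex.exp w = z ∧ Complex.exp (k * w) = 1} := by
    unfold Set.Definable₁
    simp only [Set.mem_setOf_eq]
    refine definable_setOf_exists_params (definable_setOf_and_params
      (definable_setOf_and_params (definable_mem_intSet (definableFun_proj_params _))
        (definable_setOf_not_params (definable_setOf_eq_params (definableFun_proj_params _)
          definableFun_zero'))) ?_)
    refine definable_setOf_exists_params (definable_setOf_and_params ?_ ?_)
    · exact definable_setOf_eq_params (definableFun_cexp (definableFun_proj_params _))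
        (definableFun_proj_params _)
    · exact definable_setOf_eq_params (definableFun_cexp (definableFun_mul'
        (definableFun_proj_params _) (definableFun_proj_params _))) definableFun_one'
  have heq : {z : ℂ | ∃ n : ℕ, 0 < n ∧ z ^ n = 1} =
      {z : ℂ | ∃ k : ℂ, (k ∈ intSet ∧ ¬ k = 0) ∧
        ∃ w, Complex.exp w = z ∧ Complex.exp (k * w) = 1} := by
    ext z
    simp only [Set.mem_setOf_eq, mem_intSet_iff]
    constructor
    · rintro ⟨n, hn, hz⟩
      have hz0 : z ≠ 0 := by
        rintro rfl
        rw [zero_pow hn.ne'] at hz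
        exact zero_ne_one hz
      refine ⟨n, ⟨⟨n, by simp⟩, by exact_mod_cast hn.ne'⟩, Complex.log z, Complex.exp_log hz0, ?_⟩
      have : ((n : ℂ)) * Complex.log z = ((n : ℤ) : ℂ) * Complex.log z := by simp
      rw [this, Complex.exp_int_mul, Complex.exp_log hz0, zpow_natCast, hz]
    · rintro ⟨k, ⟨⟨m, rfl⟩, hm0⟩, w, hw, h1⟩
      rw [Complex.exp_int_mul, hw] at h1
      have hm : m ≠ 0 := fun h => hm0 (by simp [h])
      refine ⟨m.natAbs, Int.natAbs_pos.2 hm, ?_⟩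
      rcases Int.natAbs_eq m with h | h
      · rw [h, zpow_natCast] at h1; exact h1
      · rw [h, zpow_neg, zpow_natCast, inv_eq_one] at h1; exact h1
  rw [heq]
  exact hdef

/-! ### The Kummer ladder -/

/-- `2 : ℂ` as a definable constant function. -/
theorem definableFun_two {α : Type*} :
    (∅ : Set ℂ).DefinableFun Language.expRing (fun _ : α → ℂ => (2 : ℂ)) := by
  simpa using definableFun_natCast' (A := (∅ : Set ℂ)) (α := α) 2

/-- **Rung `n` of the Kummer ladder ⟺ `2^{1/n} ∈ dcl(∅)`.**  For `n ≥ 1`, the class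
`T₂(n) = {ln 2 + 2πink : k ∈ ℤ}` of branches of `log 2` with index divisible by `n` is `∅`-definable in
`ℂ_exp` if and only if `e^{(ln 2)/n} = 2^{1/n}` is pointwise `∅`-definable. [folklore] -/
theorem definable₁_branchClass_iff {n : ℕ} (hn : n ≠ 0) :
    Set.Definable₁ (∅ : Set ℂ) Language.expRing
        {x : ℂ | ∃ k : ℤ, x = Real.log 2 + n * k * (2 * Real.pi * Complex.I)} ↔
      Complex.exp ((Real.log 2 : ℂ) / n) ∈ expDcl := by
  have hn' : (n : ℂ) ≠ 0 := Nat.cast_ne_zero.2 hn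
  set S : Set ℂ := {x : ℂ | ∃ k : ℤ, x = Real.log 2 + n * k * (2 * Real.pi * Complex.I)} with hS
  set c : ℂ := Complex.exp ((Real.log 2 : ℂ) / n) with hc
  constructor
  · intro hdefS
    -- `{e^u | n u ∈ S} = {c}`
    have hdef : Set.Definable₁ (∅ : Set ℂ) Language.expRing
        {y : ℂ | ∃ u : ℂ, (n : ℂ) * u ∈ S ∧ y = Complex.exp u} := by
      unfold Set.Definable₁
      simp only [Set.mem_setOf_eq]
      refine definable_setOf_exists_params (definable_setOf_and_params ?_ ?_)
      · exact definable_mem_of_definable₁ hdefS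
          (definableFun_mul' (definableFun_natCast' n) (definableFun_proj_params _))
      · exact definable_setOf_eq_params (definableFun_proj_params _)
          (definableFun_cexp (definableFun_proj_params _))
    have heq : {y : ℂ | ∃ u : ℂ, (n : ℂ) * u ∈ S ∧ y = Complex.exp u} = {c} := by
      ext y
      simp only [Set.mem_setOf_eq, Set.mem_singleton_iff, hS]
      constructor
      · rintro ⟨u, ⟨k, hk⟩, rfl⟩
        have hu : u = (Real.log 2 : ℂ) / n + k * (2 * Real.pi * Complex.I) := by
          field_simp
          linear_combination hk
        rw [hu, Complex.exp_add, Complex.exp_int_mul_two_pi_mul_I, mul_one]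
      · rintro rfl
        exact ⟨(Real.log 2 : ℂ) / n, ⟨0, by field_simp; ring⟩, rfl⟩
    show Set.Definable₁ _ _ _
    rw [← heq]
    exact hdef
  · intro hcdef
    -- `S = {x | e^x = 2 ∧ ∃ u (n u = x ∧ e^u ∈ {c})}`
    have hdef : Set.Definable₁ (∅ : Set ℂ) Language.expRing
        {x : ℂ | Complex.exp x = 2 ∧ ∃ u : ℂ, (n : ℂ) * u = x ∧ Complex.exp u ∈ ({c} : Set ℂ)} := by
      unfold Set.Definable₁
      simp only [Set.mem_setOf_eq]
      refine definable_setOf_and_params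
        (definable_setOf_eq_params (definableFun_cexp (definableFun_proj_params _))
          definableFun_two) ?_
      refine definable_setOf_exists_params (definable_setOf_and_params ?_ ?_)
      · exact definable_setOf_eq_params
          (definableFun_mul' (definableFun_natCast' n) (definableFun_proj_params _))
          (definableFun_proj_params _)
      · exact definable_mem_of_definable₁ hcdef (definableFun_cexp (definableFun_proj_params _))
    have heq : {x : ℂ | Complex.exp x = 2 ∧
        ∃ u : ℂ, (n : ℂ) * u = x ∧ Complex.exp u ∈ ({c} : Set ℂ)} = S := by
      ext x
      simp only [Set.mem_setOf_eq, Set.mem_singleton_iff, hS]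
      constructor
      · rintro ⟨-, u, hux, hu⟩
        obtain ⟨k, hk⟩ := Complex.exp_eq_exp_iff_exists_int.1 hu
        refine ⟨k, ?_⟩
        rw [← hux, hk]
        field_simp
      · rintro ⟨k, rfl⟩
        refine ⟨?_, (Real.log 2 : ℂ) / n + k * (2 * Real.pi * Complex.I), ?_, ?_⟩
        · rw [show (Real.log 2 : ℂ) + n * k * (2 * Real.pi * Complex.I) =
              (Real.log 2 : ℂ) + ((n : ℤ) * k : ℤ) * (2 * Real.pi * Complex.I) by push_cast; ring,
            Complex.exp_add, Complex.exp_int_mul_two_pi_mul_I, mul_one, exp_log_two]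
        · field_simp
        · rw [Complex.exp_add, Complex.exp_int_mul_two_pi_mul_I, mul_one]
    rw [← heq]
    exact hdef

/-- `2^{1/n}` written as a real power: `e^{(ln 2)/n} = 2^{1/n}`. [folklore] -/
theorem exp_log_two_div_eq_rpow {n : ℕ} :
    Complex.exp ((Real.log 2 : ℂ) / n) = (((2 : ℝ) ^ ((n : ℝ)⁻¹) : ℝ) : ℂ) := by
  rw [Real.rpow_def_of_pos two_pos, Complex.ofReal_exp]
  push_cast
  ring_nf

/-- **The top of the ladder implies every rung**: `ln 2 ∈ dcl(∅)` makes every class `T₂(n)`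
`∅`-definable (via `2^{1/n} = e^{(ln 2)/n} ∈ dcl(∅)`, `Negative/LogTwoHub`). -/
theorem definable₁_branchClass_of_log_two_mem_expDcl (h : (Real.log 2 : ℂ) ∈ expDcl) {n : ℕ}
    (hn : n ≠ 0) :
    Set.Definable₁ (∅ : Set ℂ) Language.expRing
      {x : ℂ | ∃ k : ℤ, x = Real.log 2 + n * k * (2 * Real.pi * Complex.I)} :=
  (definable₁_branchClass_iff hn).2 (exp_div_natCast_mem_expDcl h hn)

/-- **Rung 1 holds**: the set of all branches of `log 2` is `∅`-definable (`2 ∈ dcl(∅)`). -/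
theorem definable₁_branchClass_one :
    Set.Definable₁ (∅ : Set ℂ) Language.expRing
      {x : ℂ | ∃ k : ℤ, x = Real.log 2 + (1 : ℕ) * k * (2 * Real.pi * Complex.I)} := by
  refine (definable₁_branchClass_iff one_ne_zero).2 ?_
  rw [Nat.cast_one, div_one, exp_log_two]
  show Set.Definable₁ _ _ _
  unfold Set.Definable₁
  simp only [Set.mem_singleton_iff]
  exact definable_setOf_eq_params (definableFun_proj_params _) definableFun_two

/-- `√2 ∈ dcl^{ℂ_exp}(∅)` (the cosine trick of `Negative/BranchParity`: `√2 = e^{πi/4} + e^{-πi/4}`). -/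
theorem sqrt_two_mem_expDcl : (Real.sqrt 2 : ℂ) ∈ expDcl := by
  have hdef : Set.Definable₁ (∅ : Set ℂ) Language.expRing sqrtTwoSet := by
    unfold Set.Definable₁
    exact definable_mem_sqrtTwoSet (definableFun_proj_params _)
  have heq : sqrtTwoSet = {(Real.sqrt 2 : ℂ)} := Set.ext fun _ => mem_sqrtTwoSet_iff
  show Set.Definable₁ _ _ _
  rw [← heq]
  exact hdef

/-- **Rung 2 holds**: the class of branches of `log 2` with EVEN index is `∅`-definable
(`√2 ∈ dcl(∅)`) — the content of the refuted branch indiscernibility (`Negative/BranchParity`). -/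
theorem definable₁_branchClass_two :
    Set.Definable₁ (∅ : Set ℂ) Language.expRing
      {x : ℂ | ∃ k : ℤ, x = Real.log 2 + (2 : ℕ) * k * (2 * Real.pi * Complex.I)} := by
  refine (definable₁_branchClass_iff two_ne_zero).2 ?_
  rw [Nat.cast_ofNat, exp_half_log_two]
  exact sqrt_two_mem_expDcl

/-- **Rung 3 is KMO's open question**: the class of branches of `log 2` with index divisible by `3`
is `∅`-definable iff the real cube root of `2` — an algebraic number outside `ℚ^{ab}` — is pointwise
`∅`-definable in `ℂ_exp` (Kirby–Macintyre–Onshuus conjecture it is not: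
`Literature.ModelTheory.ExponentialFields.KMOTheoremTwoComplex`). [cite: KirbyMacintyreOnshuus2012, §1] -/
theorem definable₁_branchClass_three_iff :
    Set.Definable₁ (∅ : Set ℂ) Language.expRing
        {x : ℂ | ∃ k : ℤ, x = Real.log 2 + (3 : ℕ) * k * (2 * Real.pi * Complex.I)} ↔
      (((2 : ℝ) ^ ((3 : ℝ)⁻¹) : ℝ) : ℂ) ∈ expDcl := by
  rw [definable₁_branchClass_iff three_ne_zero, exp_log_two_div_eq_rpow]
  norm_num

end Summit.Schanuel.Schanuel.Theorems.AclSubsetLogFreeCore.Negative
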